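import Mathlib
import Literature.Analysis.Convex.SchauderFixedPoint
import HarnessLib

/-!
# The Knaster–Kuratowski–Mazurkiewicz lemma and Ky Fan's infinite-dimensional version

Knaster, Kuratowski and Mazurkiewicz (1929) proved the following covering lemma for the
standard simplex, from which they derived Brouwer's fixed point theorem
[cite: KnasterKuratowskiMazurkiewicz1929]; we state it in the pointwise form of
Aubin [cite: Aubin1993, Lemma 9.1 (66)–(67)]:

* `exists_forall_mem_of_kkm` — **KKM lemma.** Let `ι` be a finite nonempty index type and
  `F i ⊆ ℝ^ι` (`i : ι`) closed sets such that every point `x` of the standard simplex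
  `stdSimplex ℝ ι` lies in some `F i` with `x i > 0`.  Then some point of the simplex lies in
  every `F i`.
* `exists_forall_mem_of_kkm_face` / `exists_forall_mem_of_kkm_convexHull` — the classical
  formulation (e.g. von Schemde 2005, *Index and Stability in Bimatrix Games*, Thm 3.6): if for every set `s` of vertices the face spanned
  by `s` (the points of the simplex supported in `s`, equivalently the convex hull of the
  vertices `e_i`, `i ∈ s`) is covered by `⋃ i ∈ s, F i`, then `⋂ i, F i` meets the simplex.

Ky Fan (1961) extended the lemma to arbitrary topological vector spaces
[cite: Fan1961, Lemma 1] (the "Fan–KKM lemma" or "KKMF theorem"; see S. Park, *Evolution of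
the 1984 KKM theorem of Ky Fan*, Fixed Point Theory Appl. 2012:146, §3):

* `nonempty_biInter_finset_of_kkm` — finite stage: let `X ⊆ E` (a real topological vector
  space) and `F x ⊆ E` closed for `x ∈ X`, such that the convex hull of every finite subset
  `{x₁, …, xₙ} ⊆ X` is contained in `F x₁ ∪ ⋯ ∪ F xₙ` (a *KKM map*).  Then every finite
  subfamily of `{F x}_{x ∈ X}` has nonempty intersection.
* `nonempty_biInter_of_kkm` — **Fan–KKM lemma.** If moreover `F x₀` is compact for one
  `x₀ ∈ X`, then `⋂ x ∈ X, F x ≠ ∅`.  (Fan assumed `E` Hausdorff; as observed later by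
  Lassonde this is superfluous — Park, loc. cit., §4 — and no separation axiom is used here.)

## Proofs

KKM derived their lemma from Sperner's combinatorial lemma.  Here we run the implication the
other way round and use Brouwer's fixed point theorem, available in the tree as the Schauder
theorem `Literature.Analysis.Convex.exists_fixedPoint_of_mapsTo_isCompact`, through an explicit
self-map of the simplex in the style of Nash's "gain" map:
`kkmMap F x i = (x i + dist(x, F i)) / (1 + ∑ j, dist(x, F j))`.
A fixed point satisfies `x i · ∑ j dist(x, F j) = dist(x, F i)` for all `i`; the cover hypothesis
provides an `i` with `x i > 0` and `dist(x, F i) = 0`, whence `∑ j dist(x, F j) = 0` and `x` lies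
in every (closed, nonempty) `F j` — no argument by contradiction is needed.  Nonemptiness of
`F j` follows from the hypothesis at the vertex `e_j`.  Fan's lemma follows from the finite
lemma by pulling the sets back along the affine map `w ↦ ∑ w i • xᵢ` from the standard simplex
on a finite set `t ⊆ X` onto `conv t`, and then from the finite intersection property of closed
sets inside the compact set `F x₀` (`IsCompact.inter_iInter_nonempty`).

Deviations: the index set is any finite nonempty type (the lemma is FALSE for an empty index
type, the simplex being empty); faces are described by supports; in Fan's lemma the ambient
space is any real topological vector space (topological additive group with continuous scalar
multiplication), not necessarily Hausdorff.
-/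

open Set Metric

noncomputable section

namespace Literature.Analysis.Convex.KKMLemma

section Simplex

variable {ι : Type*} [Fintype ι]

/-- The self-map of `ℝ^ι` used in the fixed-point proof of the KKM lemma:
`kkmMap F x i = (x i + infDist x (F i)) / (1 + ∑ j, infDist x (F j))`. [folklore] -/
def kkmMap (F : ι → Set (ι → ℝ)) (x : ι → ℝ) : ι → ℝ :=
  fun i => (x i + infDist x (F i)) / (1 + ∑ j, infDist x (F j))

/-- The denominator of `kkmMap` is positive. [folklore] -/
private theorem one_add_sum_infDist_pos (F : ι → Set (ι → ℝ)) (x : ι → ℝ) :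
    0 < 1 + ∑ j, infDist x (F j) :=
  add_pos_of_pos_of_nonneg one_pos (Finset.sum_nonneg fun _ _ => infDist_nonneg)

/-- `kkmMap F` is continuous. [folklore] -/
private theorem continuous_kkmMap (F : ι → Set (ι → ℝ)) : Continuous (kkmMap F) := by
  refine continuous_pi fun i => ?_
  have hnum : Continuous fun x : ι → ℝ => x i + infDist x (F i) :=
    (continuous_apply i).add (continuous_infDist_pt (s := F i))
  have hden : Continuous fun x : ι → ℝ => 1 + ∑ j, infDist x (F j) :=
    continuous_const.add (continuous_finsetSum _ fun j _ => continuous_infDist_pt (s := F j))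
  exact hnum.div hden fun x => (one_add_sum_infDist_pos F x).ne'

/-- `kkmMap F` maps the standard simplex into itself. [folklore] -/
private theorem kkmMap_mem_stdSimplex (F : ι → Set (ι → ℝ)) {x : ι → ℝ} (hx : x ∈ stdSimplex ℝ ι) :
    kkmMap F x ∈ stdSimplex ℝ ι := by
  refine ⟨fun i => div_nonneg (add_nonneg (hx.1 i) infDist_nonneg)
    (one_add_sum_infDist_pos F x).le, ?_⟩
  show ∑ i, (x i + infDist x (F i)) / (1 + ∑ j, infDist x (F j)) = 1
  rw [← Finset.sum_div, Finset.sum_add_distrib, hx.2, div_self (one_add_sum_infDist_pos F x).ne']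

/-- A fixed point of `kkmMap F` satisfies `x i * ∑ j, infDist x (F j) = infDist x (F i)`.
[folklore] -/
private theorem mul_sum_eq_infDist_of_kkmMap_eq (F : ι → Set (ι → ℝ)) {x : ι → ℝ}
    (hfix : kkmMap F x = x) (i : ι) :
    x i * ∑ j, infDist x (F j) = infDist x (F i) := by
  have h := congr_fun hfix i
  simp only [kkmMap] at h
  rw [div_eq_iff (one_add_sum_infDist_pos F x).ne'] at h
  linear_combination -h

/-- **The Knaster–Kuratowski–Mazurkiewicz lemma** ("Three-Poles lemma"), pointwise form:
if `F i` (`i : ι`, a finite nonempty index type) are closed subsets of `ℝ^ι` such that every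
point `x` of the standard simplex belongs to some `F i` with `x i > 0`, then the `F i` have a
common point in the simplex.  Proved from Brouwer's fixed point theorem via `kkmMap`.
[cite: KnasterKuratowskiMazurkiewicz1929] [cite: Aubin1993, Lemma 9.1] -/
theorem exists_forall_mem_of_kkm [Nonempty ι] {F : ι → Set (ι → ℝ)} (hF : ∀ i, IsClosed (F i))
    (hcover : ∀ x ∈ stdSimplex ℝ ι, ∃ i, 0 < x i ∧ x ∈ F i) :
    ∃ x ∈ stdSimplex ℝ ι, ∀ i, x ∈ F i := by
  classical
  -- every `F i` contains the vertex `e_i`, hence is nonempty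
  have hne : ∀ i, (F i).Nonempty := by
    intro i
    obtain ⟨j, hj, hmem⟩ := hcover (Pi.single i 1) (single_mem_stdSimplex ℝ i)
    have hji : j = i := by
      by_contra h
      simp [h] at hj
    subst hji
    exact ⟨_, hmem⟩
  -- Brouwer's fixed point theorem for `kkmMap F` on the simplex
  obtain ⟨i₀⟩ := ‹Nonempty ι›
  have hSne : (stdSimplex ℝ ι).Nonempty := ⟨_, single_mem_stdSimplex ℝ i₀⟩
  have hmaps : MapsTo (kkmMap F) (stdSimplex ℝ ι) (stdSimplex ℝ ι) :=
    fun x hx => kkmMap_mem_stdSimplex F hx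
  obtain ⟨x, hx, hfix⟩ :=
    Literature.Analysis.Convex.exists_fixedPoint_of_mapsTo_isCompact (convex_stdSimplex ℝ ι)
      (isClosed_stdSimplex ℝ ι) hSne (isCompact_stdSimplex ℝ ι) (continuous_kkmMap F).continuousOn
      hmaps hmaps
  have hfix' := mul_sum_eq_infDist_of_kkmMap_eq F hfix
  -- the cover hypothesis at the fixed point kills the sum of distances
  obtain ⟨i₁, hpos, hmem⟩ := hcover x hx
  have hS0 : ∑ j, infDist x (F j) = 0 := by
    have h := hfix' i₁
    rw [infDist_zero_of_mem hmem] at h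
    rcases mul_eq_zero.mp h with h | h
    · exact absurd h hpos.ne'
    · exact h
  refine ⟨x, hx, fun i => ((hF i).mem_iff_infDist_zero (hne i)).mpr ?_⟩
  exact (Finset.sum_eq_zero_iff_of_nonneg fun j _ => (infDist_nonneg : 0 ≤ infDist x (F j))).mp
    hS0 i (Finset.mem_univ i)

/-- **KKM lemma, face formulation**: if for every finite set `s` of indices the face of the
standard simplex spanned by `s` (the points supported in `s`) is covered by `⋃ i ∈ s, F i`,
then the closed sets `F i` have a common point in the simplex.
(von Schemde 2005, Thm 3.6.) [cite: KnasterKuratowskiMazurkiewicz1929] -/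
theorem exists_forall_mem_of_kkm_face [Nonempty ι] {F : ι → Set (ι → ℝ)}
    (hF : ∀ i, IsClosed (F i))
    (hface : ∀ s : Finset ι, ∀ x ∈ stdSimplex ℝ ι, (∀ i, i ∉ s → x i = 0) → ∃ i ∈ s, x ∈ F i) :
    ∃ x ∈ stdSimplex ℝ ι, ∀ i, x ∈ F i := by
  classical
  refine exists_forall_mem_of_kkm hF fun x hx => ?_
  obtain ⟨i, hi, hmem⟩ :=
    hface (Finset.univ.filter fun i => x i ≠ 0) x hx (fun i hi => by simpa using hi)
  have hne : x i ≠ 0 := by simpa using hi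
  exact ⟨i, lt_of_le_of_ne (hx.1 i) hne.symm, hmem⟩

omit [Fintype ι] in
/-- A point of the standard simplex supported in `s` is the convex combination
`∑ i ∈ s, x i • e_i` of the vertices indexed by `s`. [folklore] -/
private theorem eq_sum_smul_single_of_support_subset [DecidableEq ι] {x : ι → ℝ} {s : Finset ι}
    (hxs : ∀ i, i ∉ s → x i = 0) :
    x = ∑ i ∈ s, x i • (Pi.single i 1 : ι → ℝ) := by
  ext j
  simp only [Finset.sum_apply, Pi.smul_apply, Pi.single_apply, smul_eq_mul, mul_ite, mul_one,
    mul_zero, Finset.sum_ite_eq]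
  split_ifs with h
  · rfl
  · exact hxs j h

/-- **KKM lemma, classical formulation with convex hulls of vertices**: if for every finite
set `s` of indices `conv {e_i : i ∈ s} ⊆ ⋃ i ∈ s, F i`, then the closed sets `F i` have a
common point in the standard simplex `conv {e_i}`.
(von Schemde 2005, Thm 3.6.) [cite: KnasterKuratowskiMazurkiewicz1929] -/
theorem exists_forall_mem_of_kkm_convexHull [Nonempty ι] [DecidableEq ι] {F : ι → Set (ι → ℝ)}
    (hF : ∀ i, IsClosed (F i))
    (hhull : ∀ s : Finset ι,
      convexHull ℝ ((fun i => (Pi.single i 1 : ι → ℝ)) '' (↑s : Set ι)) ⊆ ⋃ i ∈ s, F i) :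
    ∃ x ∈ stdSimplex ℝ ι, ∀ i, x ∈ F i := by
  classical
  refine exists_forall_mem_of_kkm_face hF fun s x hx hxs => ?_
  have hsum : ∑ i ∈ s, x i = 1 := by
    rw [← hx.2]
    exact Finset.sum_subset (Finset.subset_univ s) fun i _ hi => hxs i hi
  have hmem : x ∈ convexHull ℝ ((fun i => (Pi.single i 1 : ι → ℝ)) '' (↑s : Set ι)) := by
    rw [eq_sum_smul_single_of_support_subset hxs]
    exact (convex_convexHull ℝ _).sum_mem (fun i _ => hx.1 i) hsum
      fun i hi => subset_convexHull ℝ _ ⟨i, Finset.mem_coe.mpr hi, rfl⟩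
  obtain ⟨i, hi, hmem'⟩ := Set.mem_iUnion₂.mp (hhull s hmem)
  exact ⟨i, hi, hmem'⟩

end Simplex

section Fan

variable {E : Type*} [AddCommGroup E] [Module ℝ E] [TopologicalSpace E] [IsTopologicalAddGroup E]
  [ContinuousSMul ℝ E]

/-- **Fan–KKM lemma, finite stage.** Let `X ⊆ E` and let `F x` be closed for `x ∈ X`, such
that the convex hull of every finite subset `t ⊆ X` is contained in `⋃ x ∈ t, F x` (`F` is a
*KKM map*).  Then every finite subfamily `{F x}_{x ∈ t}`, `t ⊆ X` finite, has a common point.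
Proof: pull back along `w ↦ ∑ w i • xᵢ` to the standard simplex on `t` and apply the KKM
lemma. [cite: Fan1961, Lemma 1] -/
theorem nonempty_biInter_finset_of_kkm {X : Set E} {F : E → Set E}
    (hcl : ∀ x ∈ X, IsClosed (F x))
    (hkkm : ∀ t : Finset E, (↑t : Set E) ⊆ X → convexHull ℝ (↑t : Set E) ⊆ ⋃ x ∈ t, F x)
    (t : Finset E) (ht : (↑t : Set E) ⊆ X) :
    (⋂ x ∈ t, F x).Nonempty := by
  classical
  rcases t.eq_empty_or_nonempty with rfl | htne
  · exact ⟨0, by simp⟩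
  haveI : Nonempty t := htne.to_subtype
  -- the affine parametrisation of `conv t` by the standard simplex on `t`
  let φ : (t → ℝ) → E := fun w => ∑ i, w i • (i : E)
  have hφ : Continuous φ :=
    continuous_finsetSum _ fun i _ => (continuous_apply i).smul continuous_const
  let G : t → Set (t → ℝ) := fun i => φ ⁻¹' F i
  have hG : ∀ i, IsClosed (G i) := fun i => (hcl i (ht i.2)).preimage hφ
  -- the pulled-back sets satisfy the KKM cover condition
  have hcover : ∀ w ∈ stdSimplex ℝ t, ∃ i, 0 < w i ∧ w ∈ G i := by
    intro w hw
    let s : Finset t := Finset.univ.filter fun i => 0 < w i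
    let val : t → E := Subtype.val
    let t' : Finset E := s.image val
    have ht' : (↑t' : Set E) ⊆ X := by
      intro x hx
      obtain ⟨i, -, rfl⟩ := Finset.mem_image.mp (Finset.mem_coe.mp hx)
      exact ht i.2
    have hzero : ∀ i, i ∉ s → w i = 0 := by
      intro i hi
      have : ¬ 0 < w i := by simpa [s] using hi
      exact le_antisymm (not_lt.mp this) (hw.1 i)
    have hsum : ∑ i ∈ s, w i = 1 := by
      rw [← hw.2]
      exact Finset.sum_subset (Finset.subset_univ s) fun i _ hi => hzero i hi
    have hφ_eq : φ w = ∑ i ∈ s, w i • (i : E) := by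
      show ∑ i, w i • (i : E) = ∑ i ∈ s, w i • (i : E)
      refine (Finset.sum_subset (Finset.subset_univ s) fun i _ hi => ?_).symm
      rw [hzero i hi, zero_smul]
    have hφw : φ w ∈ convexHull ℝ (↑t' : Set E) := by
      rw [hφ_eq]
      exact (convex_convexHull ℝ _).sum_mem (fun i _ => hw.1 i) hsum
        fun i hi => subset_convexHull ℝ _ (Finset.mem_coe.mpr (Finset.mem_image_of_mem val hi))
    obtain ⟨x, hx, hmem⟩ := Set.mem_iUnion₂.mp (hkkm t' ht' hφw)
    obtain ⟨i, hi, rfl⟩ := Finset.mem_image.mp hx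
    exact ⟨i, by simpa [s] using hi, hmem⟩
  obtain ⟨w, -, hwG⟩ := exists_forall_mem_of_kkm hG hcover
  exact ⟨φ w, Set.mem_iInter₂.mpr fun x hx => hwG ⟨x, hx⟩⟩

/-- **The Fan–KKM lemma** (Ky Fan 1961): let `X` be a subset of a real topological vector
space `E` and, for `x ∈ X`, `F x ⊆ E` a closed set such that (i) the convex hull of every finite
subset `{x₁, …, xₙ}` of `X` is contained in `F x₁ ∪ ⋯ ∪ F xₙ` and (ii) `F x₀` is compact for
some `x₀ ∈ X`.  Then `⋂ x ∈ X, F x` is nonempty.  (No Hausdorff hypothesis.)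
[cite: Fan1961, Lemma 1] -/
theorem nonempty_biInter_of_kkm {X : Set E} {F : E → Set E}
    (hcl : ∀ x ∈ X, IsClosed (F x))
    (hkkm : ∀ t : Finset E, (↑t : Set E) ⊆ X → convexHull ℝ (↑t : Set E) ⊆ ⋃ x ∈ t, F x)
    {x₀ : E} (hx₀ : x₀ ∈ X) (hc : IsCompact (F x₀)) :
    (⋂ x ∈ X, F x).Nonempty := by
  classical
  have key : (F x₀ ∩ ⋂ x : X, F x).Nonempty := by
    refine hc.inter_iInter_nonempty (fun x : X => F x) (fun x => hcl x x.2) fun u => ?_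
    let val : X → E := Subtype.val
    let t : Finset E := insert x₀ (u.image val)
    have ht : (↑t : Set E) ⊆ X := by
      intro x hx
      rcases Finset.mem_insert.mp (Finset.mem_coe.mp hx) with rfl | hx
      · exact hx₀
      · obtain ⟨i, -, rfl⟩ := Finset.mem_image.mp hx
        exact i.2
    obtain ⟨y, hy⟩ := nonempty_biInter_finset_of_kkm hcl hkkm t ht
    have hy' : ∀ x ∈ t, y ∈ F x := fun x hx => (Set.mem_iInter₂.mp hy) x hx
    refine ⟨y, hy' x₀ (Finset.mem_insert_self _ _), Set.mem_iInter₂.mpr fun i hi => hy' i ?_⟩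
    exact Finset.mem_insert_of_mem (Finset.mem_image_of_mem val hi)
  obtain ⟨y, -, hy⟩ := key
  exact ⟨y, Set.mem_iInter₂.mpr fun x hx => Set.mem_iInter.mp hy ⟨x, hx⟩⟩

end Fan

#harness_tags exists_forall_mem_of_kkm
#harness_tags exists_forall_mem_of_kkm_convexHull
#harness_tags nonempty_biInter_of_kkm

end Literature.Analysis.Convex.KKMLemma
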